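import Summits.ValiantsHypothesis.ValiantsHypothesis.Theorems.LacunarySymmetroidMatrixDescartesCensusChamber739
import Summits.ValiantsHypothesis.ValiantsHypothesis.Theorems.LacunarySymmetroidMatrixDescartesCensusChamberSymmetry

/-!
# `MatrixDescartes` census — chamber 1040: complete door-A row as the MIRROR of chamber 739

HONEST FRAMING.  Object-search cell `pub-symmetroid`, door-A target `DoorA26 := PosRootLawAt 2 6 19`
(stmt-ValiantsHypothesis-19979; OPEN, typed, never asserted), crux `Theses.LacunarySymmetroid.MatrixDescartes`
(stmt-ValiantsHypothesis-18050).  Chamber 1040 of theory g6's table (smallest member `(0,14,24,29,35,47)`; words `DIIDDD` / `IDDIII`)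
is the MIRROR of chamber 739 (`d ↦ d₅ − d_{5−i}`, pair-sum order reversed and letters relabelled `i ↦ 5 − i`): the landed complete row
`Census.doorA26_on_chamber739` transfers by `Census.chamberRow_mirror` (`x ↦ 1/x`, tree file …CensusChamberSymmetry) — no second certificate.
Nothing here bears on `V = 19`, on other chambers, on `DoorA26` as a whole (OPEN), on the crux, or on `VP ≠ VNP`.

[folklore] Bookkeeping (generated by the seat's `gen_mirror.py`); elementary.
-/

-- `Summit.ValiantsHypothesis.ValiantsHypothesis.…` repeats a component by the D-0017 layout
-- (single-conjunct summit), which the `dupNamespace` linter flags; the name is mandated.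
set_option linter.dupNamespace false

namespace Summit.ValiantsHypothesis.ValiantsHypothesis.Theorems.LacunarySymmetroidMatrixDescartes.Census

/-- **DOOR-A ROW ON THE WHOLE CHAMBER 1040** (mirror of chamber 739): every exponent vector whose pair sums are ordered as in chamber 1040
(smallest member `(0,14,24,29,35,47)`) satisfies `ζ(2,6; d) ≤ 19`. [folklore] -/
theorem doorA26_on_chamber1040 (d : Fin 6 → ℕ)
    (hd : StrictMono ((fun p : Fin 6 × Fin 6 => d p.1 + d p.2) ∘
      ![(0, 0), (0, 1), (0, 2), (1, 1), (0, 3), (0, 4), (1, 2), (1, 3), (0, 5), (2, 2), (1, 4),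
        (2, 3), (3, 3), (2, 4), (1, 5), (3, 4), (4, 4), (2, 5), (3, 5), (4, 5), (5, 5)])) :
    PosRootLawOn 2 6 19 d := by
  have hσ : (fun t : Fin 21 => (((![(0, 0), (0, 1), (0, 2), (0, 3), (1, 1), (1, 2), (0, 4), (1, 3), (2, 2), (2, 3), (1, 4),
        (3, 3), (0, 5), (2, 4), (3, 4), (1, 5), (2, 5), (4, 4), (3, 5), (4, 5), (5, 5)] : Fin 21 → Fin 6 × Fin 6) (Fin.rev t)).2.rev,
      ((![(0, 0), (0, 1), (0, 2), (0, 3), (1, 1), (1, 2), (0, 4), (1, 3), (2, 2), (2, 3), (1, 4),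
        (3, 3), (0, 5), (2, 4), (3, 4), (1, 5), (2, 5), (4, 4), (3, 5), (4, 5), (5, 5)] : Fin 21 → Fin 6 × Fin 6) (Fin.rev t)).1.rev)) =
      (![(0, 0), (0, 1), (0, 2), (1, 1), (0, 3), (0, 4), (1, 2), (1, 3), (0, 5), (2, 2), (1, 4),
        (2, 3), (3, 3), (2, 4), (1, 5), (3, 4), (4, 4), (2, 5), (3, 5), (4, 5), (5, 5)] : Fin 21 → Fin 6 × Fin 6) := by
    funext t; fin_cases t <;> rfl
  refine chamberRow_mirror _ (fun d' hd' => doorA26_on_chamber739 d' hd') d ?_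
  rw [hσ]; exact hd

/-- Non-vacuity: the smallest member of chamber 1040. [folklore] -/
example : PosRootLawOn 2 6 19 (![0, 14, 24, 29, 35, 47] : Fin 6 → ℕ) :=
  doorA26_on_chamber1040 _ (Fin.strictMono_iff_lt_succ.2 (by decide))

end Summit.ValiantsHypothesis.ValiantsHypothesis.Theorems.LacunarySymmetroidMatrixDescartes.Census
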